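import Mathlib
import Summits.ResolutionOfSingularities.ResolutionOfSingularities.Theorems.RadicialJungCleanModelsCleanPatchingStepTwo
import Literature.AlgebraicGeometry.Resolution.BadCurveInduction
import HarnessLib

/-!
# Route `RadicialJung`, crux `CleanModels` (stmt-ResolutionOfSingularities-15917), line `Sketch` rev 14, stub 4b
# `stub_cleanTwoModelPatching3`: Zariski's bad-curve induction for `P_clean`, the step

Kernel transfer, part 3: the `P_clean` twins of `ProjModel.exists_modification_of_isBad` and `ProjModel.exists_step`
(`Literature/AlgebraicGeometry/Resolution/BadCurveStep.lean`; Zariski–Samuel II Ch. VI §17, Piltant 2013 Lemma 5.6).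
At a bad point `x` of `(A, U, B)` — `U ⊆ A` an open of CLEAN-REGULAR points, `B` carrying an open `U_B` of
clean-regular points — the ideal of the curve `cl{x} ∩ U` is principalized on `U` by the hypothesis `hT4` (Axiom 4
for `P_clean`, `exists_cleanExtension`), which also makes the new model `A' → A` clean-regular over `U`; Step 2 for
`P_clean` over `U_B` (`exists_hom_cleanLe_isIso_hasCentre`) gives `B' = J(N₂, A')`, clean-regular over `U_B`.  The measure
`badMeasure` and its decrease `badMeasure_lt` are `P`-independent and are used VERBATIM: the isomorphism-locus
hypothesis of `badMeasure_lt` (over opens missing the closure of the regular indeterminacy locus) follows from the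
one of the clean Step 2 (opens missing the closure of the indeterminacy locus inside `U_B ⊆ Reg B`).

* `exists_cleanModification_of_isBad` — the modification at a bad point, clean-regular over `U`;
* `exists_cleanStep` — the inductive step: the measure drops.

All PROVED (modulo the hypothesis `hT4`); nothing here proves resolution in characteristic `p`.
-/

noncomputable section

set_option linter.dupNamespace false -- mandated namespace of this single-conjunct summit

open CategoryTheory CategoryTheory.Limits AlgebraicGeometry TopologicalSpace IsLocalRing Order
open Literature.AlgebraicGeometry.Resolution Literature.AlgebraicGeometry.Motives
open Literature.AlgebraicGeometry.Resolution.ProjModel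
open Scheme.IdealSheafData

namespace Summit.ResolutionOfSingularities.ResolutionOfSingularities.Theorems.RadicialJung.CleanModels

variable {p : ℕ} {k K : Type} [Field k] [Field K] [Algebra k K]

/-- **The modification at a bad point, for `P_clean`** (twin of `ProjModel.exists_modification_of_isBad`).
Principalizing the ideal of the curve `cl{x} ∩ U` on the open `U` of clean-regular points by `hT4` and extending it
to `A` gives a morphism of projective models `ρ : A' → A` such that: `A'` is clean-regular over `U`; `ρ` is an
isomorphism over an open containing `A ∖ cl{x}`; and the local rings of `A'` at the points over `x` are first
quadratic transforms of `𝒪_{A,x}`. [cite: Piltant2013, Lemma 5.6 (proof)] -/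
theorem exists_cleanModification_of_isBad
    (hT4 : ∀ (p : ℕ), p.Prime → ∀ (S : Scheme.{0}) [IsIntegral S] [IsNoetherian S],
      CharP S.functionField p → Scheme.IsRegular S → Scheme.IsExcellent S → topologicalKrullDim S = 3 →
      ∀ G : S.functionField, (∀ s : S, CleanRegAt p (algebraMap (S.presheaf.stalk s) S.functionField) G) →
      ∀ J : S.IdealSheafData, J ≠ ⊥ →
      ∃ (S' : Scheme.{0}) (σ : S' ⟶ S) (_ : IsIntegral S') (_ : IsDominant σ),
      IsRegularCentreBlowupSeq σ J ∧ IsLocallyPrincipal (J.comap σ) ∧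
      ∀ s' : S', CleanRegAt p (algebraMap (S'.presheaf.stalk s') S'.functionField) (RatFn.functionFieldMap σ G))
    (hp : p.Prime) [CharP k p] (htr : Algebra.trdeg k K = 3) (g₀ : K) {A B : ProjModel k K} {U : A.X.Opens}
    {x : A.X} (hU : ∀ a ∈ U, ModelCleanRegAt p g₀ A a) (hx : IsBad A B U x) :
    ∃ (A' : ProjModel k K) (ρ : A'.Hom A) (V : A.X.Opens),
      (∀ a' : A'.X, ρ.f a' ∈ U → ModelCleanRegAt p g₀ A' a') ∧
      (closure ({x} : Set A.X))ᶜ ⊆ (V : Set A.X) ∧ IsIso (ρ.f ∣_ V) ∧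
      (∀ a' : A'.X, ρ.f a' = x →
        IsQuadraticTransform (A.stalkSubring x) (A'.stalkSubring a')) := by
  classical
  have hUreg : (U : Set A.X) ⊆ Scheme.regularLocus A.X := subset_regularLocus_of_modelCleanRegAt A U hU
  have hxU : x ∈ U := hx.1
  have hx2 : coheight x = 2 := hx.coheight_eq_two htr hUreg
  haveI hregx : IsRegularLocalRing (A.X.presheaf.stalk x) := isRegularLocalRing_of_mem hUreg hxU
  have hdimx : ringKrullDim (A.X.presheaf.stalk x) = 2 := by
    rw [ringKrullDim_stalk_eq_coheight, hx2]; rfl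
  /- (1) the open subscheme `U` and the point `x' ∈ U` -/
  haveI : Nonempty (U : Scheme.{0}) := ⟨⟨x, hxU⟩⟩
  have hUne : (U : Set A.X).Nonempty := ⟨x, hxU⟩
  haveI hintU : IsIntegral (U : Scheme.{0}) := isIntegral_of_isOpenImmersion U.ι
  have hregU : Scheme.IsRegular (U : Scheme.{0}) := isRegular_opens_of_modelCleanRegAt A U hU
  let x' : (U : Scheme.{0}) := ⟨x, hxU⟩
  have hx' : U.ι x' = x := rfl
  haveI hregx' : IsRegularLocalRing ((U : Scheme.{0}).presheaf.stalk x') := hregU x'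
  have hdimx' : ringKrullDim ((U : Scheme.{0}).presheaf.stalk x') = 2 := by
    rw [← hdimx]; exact (ringKrullDim_eq_of_ringEquiv (asIso (U.ι.stalkMap x')).commRingCatIsoToRingEquiv).symm
  /- (2) the ideal of the curve; its principalization on `U`, extended to `A`, keeping cleanness -/
  let J : (U : Scheme.{0}).IdealSheafData := curveIdeal x'
  have hJ : J ≠ ⊥ := by
    intro hbot
    have h1 : stalkIdeal J x' = ⊥ := by rw [hbot, stalkIdeal_bot]
    have h2 : stalkIdeal J x' = maximalIdeal _ := stalkIdeal_vanishingIdeal_closure_self x'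
    rw [h2] at h1
    have hfield : IsField ((U : Scheme.{0}).presheaf.stalk x') :=
      (IsLocalRing.isField_iff_maximalIdeal_eq).mpr h1
    have := ringKrullDim_eq_zero_of_isField hfield
    rw [hdimx'] at this
    exact absurd this (by decide)
  obtain ⟨S', X', σ, ρ, j', hintS', hint, hdomρ, hj', hσ, hlp, hpb, hprop, hbir, hproj', hsurj, hiso, hclean⟩ :=
    exists_cleanExtension hT4 hp htr g₀ A U hU hUne J hJ
  haveI := hj'
  haveI := hint
  haveI := hprop
  haveI := hiso
  haveI := hintS'
  haveI hS'noeth : IsLocallyNoetherian S' :=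
    haveI := hσ.isProper stacks02NS_holds inferInstance
    LocallyOfFiniteType.isLocallyNoetherian σ
  /- (3) chart presentations over `x'` (the tower lemma) -/
  have hcp : ∀ s' : S', σ s' = x' → ChartPresentation σ s' :=
    hσ.chartPresentation_of_isLocallyPrincipalAt hdimx' (fun s' _ => hlp s')
  /- (4) the modification model -/
  let V : A.X.Opens := principalOpen U.ι J
  have hVsub : (closure ({x} : Set A.X))ᶜ ⊆ (V : Set A.X) := by
    rw [coe_principalOpen, Set.compl_subset_compl]
    refine closure_minimal ?_ isClosed_closure
    rintro _ ⟨s, hs, rfl⟩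
    have hs' : s ∈ (J.support : Set U) := nonPrincipalLocus_le_support J hs
    rw [support_curveIdeal] at hs'
    have h1 : U.ι '' closure ({x'} : Set U) ⊆ closure (U.ι '' {x'}) :=
      image_closure_subset_closure_image U.ι.continuous
    rw [Set.image_singleton, hx'] at h1
    exact h1 ⟨s, hs', rfl⟩
  have hVne : (V : Set A.X).Nonempty := by
    refine ⟨genericPoint A.X, hVsub ?_⟩
    intro hgen
    -- the generic point is not in the closure of `x` (it would equal `x`, which is bad)
    have h1 : x ⤳ genericPoint A.X := specializes_iff_mem_closure.mpr hgen
    have h2 : genericPoint A.X ⤳ x := (genericPoint_spec A.X).specializes (Set.mem_univ x)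
    have heq : x = genericPoint A.X := (h1.antisymm h2).eq
    apply hx.2.1
    rw [heq, stalkSubring_genericPoint]
    exact B.hasCentre_top
  let A' : ProjModel k K := ofModification A ρ V hVne hproj'
  let ρA : A'.Hom A := ofModificationHom A ρ V hVne hproj'
  have hρA : ρA.f = ρ := rfl
  refine ⟨A', ρA, V, fun a' ha' => ?_, hVsub, hiso, fun a' ha' => ?_⟩
  · -- cleanness over `U`: the point comes from `S'`
    obtain ⟨s', rfl⟩ := hsurj a' ⟨⟨ρ a', ha'⟩, rfl⟩
    exact (modelCleanRegAt_ofModification_iff A ρ V hVne hproj' (j' s')).mpr (hclean s')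
  · -- points over `x`: first quadratic transforms
    obtain ⟨s', rfl⟩ := hsurj a' ⟨x', by rw [hx']; exact ha'.symm⟩
    have hw : j' ≫ ρA.f = σ ≫ U.ι := hpb.w
    have hs' : σ s' = x' := by
      apply U.ι.isOpenEmbedding.injective
      rw [← Scheme.Hom.comp_apply, ← hw, Scheme.Hom.comp_apply, hx']
      exact ha'
    haveI : IsIso (@Scheme.Hom.stalkMap S' A'.X j' s') := by
      exact (inferInstance : IsIso (j'.stalkMap s'))
    haveI : IsRegularLocalRing (A.X.presheaf.stalk (U.ι (σ s'))) := by rw [hs', hx']; exact hregx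
    have h := isQuadraticTransform_stalkSubring_of_chartPresentation ρA U σ j' hw s' (hcp s' hs')
      (hx2 := by rw [hs', hx']; exact hdimx)
    rw [hs'] at h
    exact h

/-- **The inductive step of Zariski's bad-curve induction for `P_clean`** (twin of `ProjModel.exists_step`; Piltant
2013, Lemma 5.6, without the factorizability Lemma 5.3): at a bad point `x` of `(A, U, B)` (`U` an open of
clean-regular points of `A`, `U_B` one of `B`) there are projective models `ρ : A' → A` and `B' = J(N₂, A') → B`,
`B' → A'`, with `B'` clean-regular over `U_B`, `A'` clean-regular over `U`, and a smaller measure.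
[cite: Piltant2013, Lemma 5.6; CossartPiltant2019, Prop. 4.4] -/
theorem exists_cleanStep
    (hT4 : ∀ (p : ℕ), p.Prime → ∀ (S : Scheme.{0}) [IsIntegral S] [IsNoetherian S],
      CharP S.functionField p → Scheme.IsRegular S → Scheme.IsExcellent S → topologicalKrullDim S = 3 →
      ∀ G : S.functionField, (∀ s : S, CleanRegAt p (algebraMap (S.presheaf.stalk s) S.functionField) G) →
      ∀ J : S.IdealSheafData, J ≠ ⊥ →
      ∃ (S' : Scheme.{0}) (σ : S' ⟶ S) (_ : IsIntegral S') (_ : IsDominant σ),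
      IsRegularCentreBlowupSeq σ J ∧ IsLocallyPrincipal (J.comap σ) ∧
      ∀ s' : S', CleanRegAt p (algebraMap (S'.presheaf.stalk s') S'.functionField) (RatFn.functionFieldMap σ G))
    (hp : p.Prime) [CharP k p] (htr : Algebra.trdeg k K = 3) (g₀ : K) {A B : ProjModel k K} (η : B.Hom A)
    {U : A.X.Opens} (hU : ∀ a ∈ U, ModelCleanRegAt p g₀ A a) (UB : B.X.Opens)
    (hUB : ∀ b ∈ UB, ModelCleanRegAt p g₀ B b) {x : A.X} (hx : IsBad A B U x) :
    ∃ (A' B' : ProjModel k K) (ρ : A'.Hom A) (_ : B'.Hom A') (θ : B'.Hom B),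
      (∀ b' : B'.X, θ.f b' ∈ UB → ModelCleanRegAt p g₀ B' b') ∧
      (∀ a' : A'.X, ρ.f a' ∈ U → ModelCleanRegAt p g₀ A' a') ∧
      badMeasure A' (ρ.f ⁻¹ᵁ U) B' < badMeasure A U B := by
  have hUreg : (U : Set A.X) ⊆ Scheme.regularLocus A.X := subset_regularLocus_of_modelCleanRegAt A U hU
  have hUBreg : (UB : Set B.X) ⊆ Scheme.regularLocus B.X := subset_regularLocus_of_modelCleanRegAt B UB hUB
  obtain ⟨A', ρ, V, hcleanU', hV, hisoV, hqt⟩ := exists_cleanModification_of_isBad hT4 hp htr g₀ hU hx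
  haveI := hisoV
  have hregU' : ∀ a' : A'.X, ρ.f a' ∈ U → IsRegularLocalRing (A'.X.presheaf.stalk a') :=
    fun a' ha' => (hcleanU' a' ha').isRegularLocalRing_stalk
  -- Step 2 for `P_clean`, for the pair `(A', B)` over `U_B`
  obtain ⟨N₂, ψ, hclean, hiso1⟩ := exists_hom_cleanLe_isIso_hasCentre hT4 hp htr g₀ A' B UB hUB
  have hiso1' : ∀ W : B.X.Opens, Disjoint (W : Set B.X)
      (closure ({m : B.X | ¬ A'.HasCentre (B.stalkSubring m)} ∩ Scheme.regularLocus B.X)) →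
        IsIso (ψ.f ∣_ W) :=
    fun W hW => hiso1 W (hW.mono_right (closure_mono (Set.inter_subset_inter_right _ hUBreg)))
  refine ⟨A', join N₂ A', ρ, joinSnd N₂ A', (joinFst N₂ A').comp ψ, hclean, hcleanU', ?_⟩
  exact badMeasure_lt htr η ρ ψ hUreg hx hregU' hqt hV hiso1'

end Summit.ResolutionOfSingularities.ResolutionOfSingularities.Theorems.RadicialJung.CleanModels

end
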